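import Literature.NumberTheory.EllipticCurves.OpenImageMazurProofs
import Literature.NumberTheory.EllipticCurves.BSDSelmerSmithNoRationalTwoTorsionProofs
import HarnessLib

/-!
# `E[2]` is a reducible `Γ_ℚ`-module iff the `2`-division cubic has a rational root

Topic `Literature/NumberTheory/EllipticCurves`; THEOREMS ONLY (no definition, no named fact), the
`p = 2` twin over `ℚ` of `ModThreeReducibleIffPsi3Root` (`E[3]` reducible iff `Ψ₃` has a root).

J. H. Silverman, *The Arithmetic of Elliptic Curves*, 2nd ed. (2009), III.2.3 and Exercise 3.7(b)
(`ψ₂ = 2y + a₁x + a₃`, `ψ₂² = 4x³ + b₂x² + 2b₄x + b₆`; the non-zero `2`-torsion points are the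
`(x, y)` with `x` a root of the `2`-division cubic), VIII.§1; J. E. Cremona, *Algorithms for Modular
Elliptic Curves*, 2nd ed. (1997), §3.8 (a subgroup of order `l` is determined by a rational factor of
the `l`-division polynomial).  Over `𝔽₂` a line of `E[2] ≅ 𝔽₂²` is a single non-zero vector, so a
`Γ_ℚ`-stable line IS a rational point of order `2`:

* `not_hasIrreducibleModPGaloisRep_two_of_isRoot_twoTorsionPolynomial` — a rational root of
  `4x³ + b₂x² + 2b₄x + b₆` gives a non-zero `Γ_ℚ`-fixed point of `E[2]` (tree:
  `ratTwoTorsionCard_ne_one_of_isRoot`), whose span `{O, P}` is a stable subgroup of order `2`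
  (tree: `Mazur1978.not_hasIrreducibleModPGaloisRep_iff_exists_natCard_eq`);
* `exists_isRoot_twoTorsionPolynomial_of_not_hasIrreducibleModPGaloisRep_two` — conversely a stable
  subgroup of order `2` is `{O, P}` (`Mazur1978.exists_eq_zmultiples_of_natCard_eq`), `σP ∈ {O, P}` and
  `σP ≠ O` force `σP = P`, so `#E(ℚ)[2] ≠ 1` and the cubic has a rational root (tree:
  `exists_isRoot_twoTorsionPolynomial_of_ratTwoTorsionCard_ne_one`);
* the packaging `not_hasIrreducibleModPGaloisRep_two_iff_exists_isRoot_twoTorsionPolynomial`.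

In the cell `bsd-f2-manin` this is the dictionary «`Rb` = reducible `E[2]` = rational 2-torsion»
used throughout the census of the reducible residual of `ManinOddAtFour`.  Nothing about any particular
curve is asserted.
-/

noncomputable section

open scoped Classical

namespace WeierstrassCurve

open Polynomial Field Literature.NumberTheory.EllipticCurves

variable (W : WeierstrassCurve ℚ) [W.IsElliptic]

omit [W.IsElliptic] in
/-- `#E(ℚ)[2] ≠ 1` iff some NON-ZERO point of `E[2]` is fixed by `Γ_ℚ` (the fixed-point set always
contains `O`). [folklore] -/
private theorem ratTwoTorsionCard_ne_one_iff_exists_fixed_ne_zero :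
    ratTwoTorsionCard W ≠ 1 ↔
      ∃ Q : geomTorsion W (2 : ℤ), Q ≠ 0 ∧ ∀ σ : absoluteGaloisGroup ℚ, σ • Q = Q := by
  rw [ratTwoTorsionCard, Ne, Nat.card_eq_one_iff_exists]
  constructor
  · intro h
    by_contra hne
    push Not at hne
    apply h
    refine ⟨⟨0, fun σ => smul_zero σ⟩, fun ⟨Q, hQ⟩ => Subtype.ext ?_⟩
    by_contra hQ0
    obtain ⟨σ, hσ⟩ := hne Q hQ0
    exact hσ (hQ σ)
  · rintro ⟨Q, hQ0, hQ⟩ ⟨Q₀, hQ₀⟩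
    have h1 := hQ₀ ⟨Q, hQ⟩
    have h2 := hQ₀ ⟨0, fun σ => smul_zero σ⟩
    exact hQ0 (by
      have := congrArg Subtype.val (h1.trans h2.symm)
      exact this)

/-- **A rational root of the `2`-division cubic makes `E[2]` reducible**: the rational point
`P = (x₀, −(a₁x₀ + a₃)/2)` of order `2` spans the `Γ_ℚ`-stable subgroup `{O, P}` of order `2` of
`E[2]`. [cite: SilvermanAEC2009, III.2.3 and Exercise 3.7(b)] [cite: Cremona1997, §3.8] -/
theorem not_hasIrreducibleModPGaloisRep_two_of_isRoot_twoTorsionPolynomial {x₀ : ℚ}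
    (hx : W.twoTorsionPolynomial.toPoly.IsRoot x₀) : ¬ W.HasIrreducibleModPGaloisRep 2 := by
  haveI : Fact (Nat.Prime 2) := ⟨Nat.prime_two⟩
  obtain ⟨Q, hQ0, hQ⟩ := (ratTwoTorsionCard_ne_one_iff_exists_fixed_ne_zero W).mp
    (ratTwoTorsionCard_ne_one_of_isRoot W hx)
  refine (Mazur1978.not_hasIrreducibleModPGaloisRep_iff_exists_natCard_eq W 2).mpr
    ⟨AddSubgroup.zmultiples Q, fun σ P hP => ?_, ?_⟩
  · obtain ⟨k, rfl⟩ := AddSubgroup.mem_zmultiples_iff.mp hP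
    rw [show σ • (k • Q) = k • (σ • Q) from
      map_zsmul (DistribSMul.toAddMonoidHom (↥(geomTorsion W 2)) σ) k Q, hQ]
    exact AddSubgroup.zsmul_mem_zmultiples Q k
  · have h2Q : (2 : ℕ) • Q = 0 := by
      apply Subtype.ext
      have h := (mem_geomTorsion_iff W 2 _).mp Q.2
      rw [AddSubgroup.coe_nsmul, AddSubgroup.coe_zero, ← natCast_zsmul]
      exact_mod_cast h
    have hord : addOrderOf Q = 2 := by
      refine (addOrderOf_eq_prime_iff).mpr ⟨h2Q, hQ0⟩
    rw [Nat.card_zmultiples, hord]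

/-- **Reducible `E[2]` gives a rational root of the `2`-division cubic**: a `Γ_ℚ`-stable subgroup of
order `2` is `{O, P}`; `σP ∈ {O, P}` with `σP ≠ O` forces `σP = P`, so `P` is a non-zero rational
`2`-torsion point and `x(P)` is a root of `4x³ + b₂x² + 2b₄x + b₆`.
[cite: SilvermanAEC2009, III.2.3 and Exercise 3.7(b); VIII.§1] [cite: Cremona1997, §3.8] -/
theorem exists_isRoot_twoTorsionPolynomial_of_not_hasIrreducibleModPGaloisRep_two
    (hred : ¬ W.HasIrreducibleModPGaloisRep 2) :
    ∃ x₀ : ℚ, W.twoTorsionPolynomial.toPoly.IsRoot x₀ := by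
  haveI : Fact (Nat.Prime 2) := ⟨Nat.prime_two⟩
  haveI : NeZero ((2 : ℕ) : ℚ) := ⟨by norm_num⟩
  obtain ⟨H, hH, hcard⟩ :=
    (Mazur1978.not_hasIrreducibleModPGaloisRep_iff_exists_natCard_eq W 2).mp hred
  obtain ⟨P, hP0, rfl⟩ := Mazur1978.exists_eq_zmultiples_of_natCard_eq W 2 hcard
  have h2P : (2 : ℤ) • P = 0 := by
    apply Subtype.ext
    have h := (mem_geomTorsion_iff W 2 _).mp P.2
    rw [AddSubgroup.coe_zsmul, AddSubgroup.coe_zero]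
    exact_mod_cast h
  have hfix : ∀ σ : absoluteGaloisGroup ℚ, σ • P = P := by
    intro σ
    have hmem : σ • P ∈ AddSubgroup.zmultiples P := hH σ P (AddSubgroup.mem_zmultiples P)
    obtain ⟨k, hk⟩ := AddSubgroup.mem_zmultiples_iff.mp hmem
    have hσ0 : σ • P ≠ 0 := by
      intro h0
      apply hP0
      have := congrArg (fun Q ↦ σ⁻¹ • Q) h0
      simpa using this
    obtain ⟨q, r, hkqr, hr⟩ : ∃ q r : ℤ, k = r + q * 2 ∧ (r = 0 ∨ r = 1) :=
      ⟨k / 2, k % 2, by omega, by omega⟩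
    have hk2 : k • P = r • P := by
      rw [hkqr, add_zsmul, mul_zsmul, h2P, zsmul_zero, add_zero]
    rcases hr with rfl | rfl
    · rw [zero_zsmul] at hk2
      exact (hσ0 (hk.symm.trans hk2)).elim
    · rw [one_zsmul] at hk2
      exact hk.symm.trans hk2
  apply exists_isRoot_twoTorsionPolynomial_of_ratTwoTorsionCard_ne_one
  rw [ratTwoTorsionCard_ne_one_iff_exists_fixed_ne_zero]
  refine ⟨⟨(P : geomPoints W), ?_⟩, ?_, fun σ => Subtype.ext ?_⟩
  · exact (mem_geomTorsion_iff W 2 _).mpr ((mem_geomTorsion_iff W 2 _).mp P.2)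
  · intro h0
    exact hP0 (Subtype.ext (congrArg Subtype.val h0))
  · rw [AddSubgroup.torsionBy.coe_smul]
    have := congrArg Subtype.val (hfix σ)
    rwa [AddSubgroup.torsionBy.coe_smul] at this

/-- **`E[2]` is a reducible `Γ_ℚ`-module iff the `2`-division cubic `4x³ + b₂x² + 2b₄x + b₆` has a
rational root** (iff `E(ℚ)[2] ≠ 0`). [cite: SilvermanAEC2009, III.2.3 and Exercise 3.7(b)]
[cite: Cremona1997, §3.8] -/
theorem not_hasIrreducibleModPGaloisRep_two_iff_exists_isRoot_twoTorsionPolynomial :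
    ¬ W.HasIrreducibleModPGaloisRep 2 ↔ ∃ x₀ : ℚ, W.twoTorsionPolynomial.toPoly.IsRoot x₀ :=
  ⟨W.exists_isRoot_twoTorsionPolynomial_of_not_hasIrreducibleModPGaloisRep_two,
    fun ⟨_, hx⟩ => W.not_hasIrreducibleModPGaloisRep_two_of_isRoot_twoTorsionPolynomial hx⟩

end WeierstrassCurve

end
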